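import Summits.RiemannHypothesis.RiemannHypothesis.Theorems.PfPersistenceAdmissibleClass

/-!
# PF persistence — the LOCALITY and UNIFORM-MODULUS barriers over the admissible class (pub-rhpf, barrier-typer)

**HONEST FRAMING. This is a long-odds MECHANISM SEARCH; no RH claims.** Companion of `PfPersistenceAdmissibleClass.lean`
(objects `Window`, `Datum`, `zetaDatum`, `dialSpace`, `Separates`, `FinitelyDetermined`, `UniformlyRobustAt`; labels
PROVED / TYPED / DATA as there).
* §5 **LOCALITY BARRIER (PROVED, RH-free)** `finitelyDetermined_meets_dialNegativesNe`: no criterion determined by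
  finitely many windows contains `ζ`'s datum and misses the negative part of the arithmetic dial space — amplify ONE
  prime `p` beyond the reach `e^{2a}` of the windows read (those matrices are IDENTICAL, `evenBlock_dial_of_not_mem`)
  until the genuine window `logWindow p = (log p, 0)` is negative (`exists_dial_negative_gt`); the witness is NAMED
  `≠ ζ` (`datumOf_dial_ne`, `exists_heavyDial_mem_negative`). Corollaries `finitelyRobustAt_meets_dialNegativesNe`,
  `not_separates_of_finitelyDetermined`. Closes leaves `L1`/`Lk` for GLOBAL separation.
* §6 **UNIFORM-MODULUS BARRIER** `not_uniformlyRobust_of_negativesAccumulate(Ne)` (PROVED) with accumulation PROVED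
  over the full operator domain from the TYPED Galerkin upper law (`negativesAccumulateNe_univ_of_galerkinInfZero`,
  shift family) and TYPED in-domain (prime dials: `PfPersistenceDialLemma.lean`); `uniformlyClose_dial` modulo
  `PrimePatternFormBounded` — REFUTED AS TYPED (unguarded `∀ win`; kept verbatim as a negative edge; the guarded
  `PrimePatternFormBoundedOn` + its proof live in DialLemma / ThetaIntegral).
* §7 the positive class itself is not finitely determined (`positiveClass_not_finitelyDetermined`).
Re-type 2026-08-19 (REFEREE r7 §1): `Window` carries `ha : 0 < a`. APPEND-ONLY: every v1 statement is kept verbatim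
(`exists_dial_negative`, `finitelyDetermined_meets_dialNegatives`, `finitelyRobustAt_meets_dialNegatives`, …, the
interface of `PfPersistenceDialLemma.lean`); the named-witness forms are the NEW `…_gt` / `…Ne` declarations.
-/

set_option linter.dupNamespace false  -- the mandated namespace repeats `RiemannHypothesis`

noncomputable section

open Real MeasureTheory intervalIntegral Finset Matrix

namespace Summit.RiemannHypothesis.RiemannHypothesis.Theorems.PfPersistence

/-! ## §5 The LOCALITY BARRIER (PROVED, RH-free): finitely many windows never separate -/

/-- The one-prime DIAL: multiply the weight at `p` by `K` (`K = 0` deletion, `K = 1 ± t` the two-sided `p`-dial,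
`K ≫ 1` a heavy Beurling prime). [folklore] -/
def dial (p : ℕ) (K : ℝ) (w : Weights) : Weights := fun q => if q = p then K * w q else w q

/-- PROVED: `p ∉ primeRange L ↔ e^{L} < p`. [folklore] -/
theorem not_mem_primeRange_iff {L : ℝ} {p : ℕ} : p ∉ primeRange L ↔ Real.exp L < p := by
  rw [primeRange, Finset.mem_range, not_lt, Nat.add_one_le_iff]
  exact Nat.floor_lt (Real.exp_pos L).le

/-- PROVED: the prime part after a dial at `p ∈ primeRange L` changes by `2 (K − 1) w(p) Θ(log p)`. [folklore] -/
theorem WP_dial_of_mem {L : ℝ} {p : ℕ} (hp : p ∈ primeRange L) (K : ℝ) (w : Weights) (Θ : ℝ → ℝ) :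
    WP L (dial p K w) Θ = WP L w Θ + 2 * (K - 1) * w p * Θ (Real.log p) := by
  have h : ∀ q ∈ primeRange L, dial p K w q * Θ (Real.log q)
      = w q * Θ (Real.log q) + (if q = p then (K - 1) * w q * Θ (Real.log q) else 0) := by
    intro q _
    by_cases hq : q = p
    · subst hq; simp [dial]; ring
    · simp [dial, hq]
  rw [WP, WP, Finset.sum_congr rfl h, Finset.sum_add_distrib, Finset.sum_ite_eq' (primeRange L) p]
  simp [hp]; ring

/-- PROVED: a dial at `p ∉ primeRange L` does not change the prime part. [folklore] -/
theorem WP_dial_of_not_mem {L : ℝ} {p : ℕ} (hp : p ∉ primeRange L) (K : ℝ) (w : Weights) (Θ : ℝ → ℝ) :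
    WP L (dial p K w) Θ = WP L w Θ := by
  have h : ∀ q ∈ primeRange L, dial p K w q * Θ (Real.log q) = w q * Θ (Real.log q) := by
    intro q hq
    have hqp : q ≠ p := fun hqp => hp (hqp ▸ hq)
    simp [dial, hqp]
  rw [WP, WP, Finset.sum_congr rfl h]

/-- **PROVED (LOCALITY)**: a dial at a prime power beyond the reach of the window, `e^{2a} < p`, leaves the window
matrix IDENTICAL. [folklore] -/
theorem evenBlock_dial_of_not_mem {p : ℕ} {win : Window} (hp : Real.exp (2 * win.a) < p) (K : ℝ) (w : Weights) :
    evenBlock (dial p K w) win = evenBlock w win := by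
  ext n m
  simp only [evenBlock, weil]
  rw [WP_dial_of_not_mem (not_mem_primeRange_iff.2 hp)]

/-- PROVED: entrywise, a dial at `p ∈ primeRange (2a)` shifts the even block by `−2 (K−1) w(p) θ_{nm}(log p)`. [folklore] -/
theorem evenBlock_dial_apply {p : ℕ} {win : Window} (hp : p ∈ primeRange (2 * win.a)) (K : ℝ) (w : Weights)
    (n m : Fin (win.N + 1)) :
    evenBlock (dial p K w) win n m
      = evenBlock w win n m - 2 * (K - 1) * w p * thetaEven (2 * win.a) n m (Real.log p) := by
  simp only [evenBlock, weil]; rw [WP_dial_of_mem hp]; ring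

/-- The ONE-PRIME PATTERN at a window: `(n, m) ↦ θ_{nm}(log p)` — the direction in which the `p`-dial moves the
even block (FRAMING §3's `B`). [folklore] -/
def primePattern (p : ℕ) (win : Window) : Matrix (Fin (win.N + 1)) (Fin (win.N + 1)) ℝ :=
  fun n m => thetaEven (2 * win.a) n m (Real.log p)

/-- PROVED: `evenBlock (dial p K w) = evenBlock w − (2 (K−1) w(p)) • primePattern p` at windows reaching `p`. [folklore] -/
theorem evenBlock_dial_eq {p : ℕ} {win : Window} (hp : p ∈ primeRange (2 * win.a)) (K : ℝ) (w : Weights) :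
    evenBlock (dial p K w) win = evenBlock w win - (2 * (K - 1) * w p) • primePattern p win := by
  ext n m
  simp only [evenBlock_dial_apply hp, primePattern, Matrix.sub_apply, Matrix.smul_apply, smul_eq_mul]

/-- **REFUTED AS TYPED — settled negative edge, kept VERBATIM so its refutations elaborate** (barrier-prover
`not_primePatternFormBounded_two`, DialLemma; fake-4 `not_primePatternFormBounded`): `∀ win` includes windows NOT
reaching `p`, where the closed form `thetaEven` is evaluated outside `[0, L]` (`a = log p / 8`, `N = 0`, `v = 1`: form
`= −3`). GUARDED form: `PrimePatternFormBoundedOn` (DialLemma), proved via `primePattern_form_abs_le` (ThetaIntegral). [folklore] -/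
def PrimePatternFormBounded (p : ℕ) : Prop :=
  ∀ win : Window, ∀ v : Fin (win.N + 1) → ℝ, |v ⬝ᵥ (primePattern p win *ᵥ v)| ≤ v ⬝ᵥ v

/-- `v ⬝ᵥ v ≥ 0` over `ℝ`. [folklore] -/
theorem dotProduct_self_nonneg_real {m : ℕ} (v : Fin m → ℝ) : 0 ≤ v ⬝ᵥ v :=
  Finset.sum_nonneg fun i _ => mul_self_nonneg (v i)

/-- **PROVED, but VACUOUS AS TYPED for `p ≥ 2`** (hypothesis refuted, see `PrimePatternFormBounded`; live versions:
`uniformlyClose_dial_of_boundedOn` (DialLemma), unconditional `dial_form_abs_le` (ThetaIntegral)): the `p`-dial by `K`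
is UNIFORMLY `2 |K−1| |w(p)|`-close (and invisible in `τ_fin` below `p`, `evenBlock_dial_of_not_mem`). [folklore] -/
theorem uniformlyClose_dial {p : ℕ} (hP : PrimePatternFormBounded p) (K : ℝ) (w : Weights) :
    UniformlyClose (2 * |K - 1| * |w p|) (datumOf w) (datumOf (dial p K w)) := by
  intro win v
  by_cases hp : p ∈ primeRange (2 * win.a)
  · have h : datumOf w win - datumOf (dial p K w) win = (2 * (K - 1) * w p) • primePattern p win := by
      simp only [datumOf, evenBlock_dial_eq hp, sub_sub_cancel]
    rw [h, Matrix.smul_mulVec, dotProduct_smul, smul_eq_mul, abs_mul, abs_mul, abs_mul, abs_two]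
    have := hP win v
    have h2 : 0 ≤ 2 * |K - 1| * |w p| := by positivity
    exact mul_le_mul_of_nonneg_left this h2
  · have h : datumOf w win - datumOf (dial p K w) win = 0 := by
      simp only [datumOf, evenBlock_dial_of_not_mem (not_mem_primeRange_iff.1 hp), sub_self]
    rw [h, Matrix.zero_mulVec, dotProduct_zero, abs_zero]
    have := dotProduct_self_nonneg_real v
    positivity

/-- PROVED: the `(0,0)` test function is `θ_{ξ_0, ξ_0}(y) = (L − y)/L`. [folklore] -/
theorem thetaEven_zero_zero (L : ℝ) : thetaEven L 0 0 = fun y => (L - y) / L := by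
  funext y; simp [thetaEven]

/-- PROVED: the Rayleigh value of the first basis vector is the `(0,0)` entry. [folklore] -/
theorem single_zero_rayleigh {n : ℕ} (M : Matrix (Fin (n + 1)) (Fin (n + 1)) ℝ) :
    (Pi.single 0 1 : Fin (n + 1) → ℝ) ⬝ᵥ (M *ᵥ Pi.single 0 1) = M 0 0 := by
  simp [Matrix.mulVec, dotProduct, Pi.single_apply]

/-- PROVED: the `(0,0)` entry of the dialled even block is affine in `K` with slope
`−2 w(p) (2a − log p)/(2a)`. [folklore] -/
theorem evenBlock_dial_zero_zero {p : ℕ} {win : Window} (hp : p ∈ primeRange (2 * win.a)) (K : ℝ) (w : Weights) :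
    evenBlock (dial p K w) win 0 0
      = evenBlock w win 0 0 - 2 * (K - 1) * w p * ((2 * win.a - Real.log p) / (2 * win.a)) := by
  rw [evenBlock_dial_apply hp]
  simp only [Fin.val_zero, thetaEven_zero_zero]

/-- PROVED: `log p ≤ L ⇒ p ∈ primeRange L` (the support of length `L` reaches the prime power `p`). [folklore] -/
theorem mem_primeRange_of_log_le {p : ℕ} {L : ℝ} (hp : Real.log p ≤ L) : p ∈ primeRange L := by
  rw [primeRange, Finset.mem_range, Nat.lt_add_one_iff, Nat.le_floor_iff (Real.exp_pos _).le]
  rcases Nat.eq_zero_or_pos p with h0 | h0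
  · subst h0; simp [(Real.exp_pos _).le]
  · have hp' : (0 : ℝ) < p := by exact_mod_cast h0
    have := Real.exp_le_exp.2 hp
    rwa [Real.exp_log hp'] at this

/-- **PROVED (the far-prime witness, amplification NAMED `K > 1`)**: at a window reaching the prime power `p`
(`log p < 2a`), for a weight table with `w(p) > 0`, some `K > 1` (so the dialled table is never the original one,
`datumOf_dial_ne`) makes the first basis vector's Rayleigh value `< 0`. [folklore] -/
theorem exists_dial_negative_gt {p : ℕ} {win : Window} (ha : 0 < win.a) (hp : Real.log p < 2 * win.a)
    {w : Weights} (hw : 0 < w p) :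
    ∃ K : ℝ, 1 < K ∧ ∃ v : Fin (win.N + 1) → ℝ, v ⬝ᵥ (evenBlock (dial p K w) win *ᵥ v) < 0 := by
  have hL : 0 < 2 * win.a := by linarith [ha]
  have hmem : p ∈ primeRange (2 * win.a) := mem_primeRange_of_log_le hp.le
  obtain ⟨s, hs⟩ : ∃ s : ℝ, s = w p * ((2 * win.a - Real.log p) / (2 * win.a)) := ⟨_, rfl⟩
  obtain ⟨c, hc⟩ : ∃ c : ℝ, c = evenBlock w win 0 0 := ⟨_, rfl⟩
  have hspos : 0 < s := by
    rw [hs]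
    exact mul_pos hw (div_pos (by linarith) hL)
  have hs0 : s ≠ 0 := hspos.ne'
  refine ⟨1 + (max c 0 + 1) / (2 * s), ?_, Pi.single 0 1, ?_⟩
  · have : 0 < (max c 0 + 1) / (2 * s) := div_pos (by linarith [le_max_right c 0]) (by linarith)
    linarith
  rw [single_zero_rayleigh, evenBlock_dial_zero_zero hmem, ← hc]
  have hcalc : 2 * (1 + (max c 0 + 1) / (2 * s) - 1) * w p * ((2 * win.a - Real.log p) / (2 * win.a))
      = max c 0 + 1 := by
    rw [mul_assoc (2 * (1 + (max c 0 + 1) / (2 * s) - 1)), ← hs]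
    field_simp; ring
  rw [hcalc]
  linarith [le_max_left c 0]

/-- PROVED (v1 statement, kept verbatim — append-only; `ha` is now also the field `win.ha`; named form `…_gt`). [folklore] -/
theorem exists_dial_negative {p : ℕ} {win : Window} (ha : 0 < win.a) (hp : Real.log p < 2 * win.a)
    {w : Weights} (hw : 0 < w p) :
    ∃ K : ℝ, ∃ v : Fin (win.N + 1) → ℝ, v ⬝ᵥ (evenBlock (dial p K w) win *ᵥ v) < 0 :=
  let ⟨K, _, hK⟩ := exists_dial_negative_gt ha hp hw; ⟨K, hK⟩

/-- The GENUINE window `(log p, 0)` attached to a prime power `p ≥ 2` (`0 < log p`). [folklore] -/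
def logWindow (p : ℕ) (hp : 2 ≤ p) : Window :=
  ⟨Real.log p, 0, Real.log_pos (by exact_mod_cast (by omega : 1 < p))⟩

/-- PROVED: `(logWindow p hp).a = log p`. [folklore] -/
@[simp] theorem logWindow_a (p : ℕ) (hp : 2 ≤ p) : (logWindow p hp).a = Real.log p := rfl

/-- PROVED: the window `(log p, 0)` reaches `p`. [folklore] -/
theorem mem_primeRange_logWindow (p : ℕ) (hp : 2 ≤ p) : p ∈ primeRange (2 * (logWindow p hp).a) := by
  apply mem_primeRange_of_log_le
  rw [logWindow_a]
  linarith [Real.log_pos (show (1 : ℝ) < p by exact_mod_cast (by omega : 1 < p))]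

/-- **PROVED (the witnesses are never `ζ`)**: a dial with `K ≠ 1` at a prime power `p ≥ 2` carrying weight
`w(p) ≠ 0` CHANGES the datum — the `(0,0)` entry at the genuine window `(log p, 0)` moves by `(K − 1) w(p)`.
With `w = zetaWeights`, `p` prime: `datumOf (dial p K zetaWeights) ≠ zetaDatum`. [folklore] -/
theorem datumOf_dial_ne {p : ℕ} (hp : 2 ≤ p) {K : ℝ} (hK : K ≠ 1) {w : Weights} (hw : w p ≠ 0) :
    datumOf (dial p K w) ≠ datumOf w := by
  intro h
  have hlogp : 0 < Real.log p := Real.log_pos (by exact_mod_cast (by omega : 1 < p))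
  have h00 := congrArg (fun d : Datum => d (logWindow p hp) 0 0) h
  simp only [datumOf] at h00
  rw [evenBlock_dial_zero_zero (mem_primeRange_logWindow p hp), logWindow_a] at h00
  have hfrac : (2 * Real.log p - Real.log p) / (2 * Real.log p) = 1 / 2 := by
    field_simp; ring
  rw [hfrac] at h00
  have hzero : (K - 1) * w p = 0 := by linarith
  rcases mul_eq_zero.1 hzero with h1 | h1
  · exact hK (by linarith)
  · exact hw h1

/-- PROVED: `ζ`'s weight at a prime is positive. [folklore] -/
theorem zetaWeights_pos_of_prime {p : ℕ} (hp : p.Prime) : 0 < zetaWeights p := by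
  have hp0 : (0 : ℝ) < p := by exact_mod_cast hp.pos
  unfold zetaWeights; apply mul_pos
  · rw [ArithmeticFunction.vonMangoldt_apply_prime hp]
    exact Real.log_pos (by exact_mod_cast hp.one_lt)
  · exact Real.rpow_pos_of_pos hp0 _

/-- **PROVED — THE LOCALITY BARRIER (RH-free), witness NAMED (REFEREE r7 §1).** Given the finite window set `W`,
pick a prime `p` beyond `e^{2a}` for every window of `W` (locality: those matrices do not move under any dial at `p`)
and an amplification `K > 1` making the genuine window `(log p, 0)` negative (`exists_dial_negative_gt`): the heavy
dial `datumOf (dial p K zetaWeights)` lies in `S`. Hence NO functional of finitely many observatory records (any value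
type, resolution, tier ≤ `coupling`) certifies all-window positivity on `D(𝒲)`: leaves `L1`, `Lk` CLOSED globally. [folklore] -/
theorem exists_heavyDial_mem_negative {S : Set Datum} (hS : FinitelyDetermined S) (hζ : zetaDatum ∈ S) :
    ∃ (p : ℕ) (hp : p.Prime) (K : ℝ), 1 < K ∧ datumOf (dial p K zetaWeights) ∈ S ∧
      ∃ v : Fin ((logWindow p hp.two_le).N + 1) → ℝ,
        v ⬝ᵥ (datumOf (dial p K zetaWeights) (logWindow p hp.two_le) *ᵥ v) < 0 := by
  obtain ⟨W, hW⟩ := hS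
  -- a natural number beyond the reach `e^{2a}` of every window in `W`
  let B : ℕ := (W.image fun win => ⌈Real.exp (2 * win.a)⌉₊).sup id + 1
  have hB : ∀ win ∈ W, Real.exp (2 * win.a) < B := by
    intro win hwin
    have h1 : Real.exp (2 * win.a) ≤ (⌈Real.exp (2 * win.a)⌉₊ : ℝ) := Nat.le_ceil _
    have h2 : ⌈Real.exp (2 * win.a)⌉₊ ≤ (W.image fun win => ⌈Real.exp (2 * win.a)⌉₊).sup id :=
      Finset.le_sup (f := id) (Finset.mem_image_of_mem _ hwin)
    have h2' : (⌈Real.exp (2 * win.a)⌉₊ : ℝ) ≤ ((W.image fun win => ⌈Real.exp (2 * win.a)⌉₊).sup id : ℕ) := by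
      exact_mod_cast h2
    have h3 : (B : ℝ) = ((W.image fun win => ⌈Real.exp (2 * win.a)⌉₊).sup id : ℕ) + 1 := by
      simp only [B]; push_cast; ring
    linarith
  -- a prime `p ≥ max B 2`
  obtain ⟨p, hpB, hp⟩ := Nat.exists_infinite_primes (max B 2)
  have hpB' : (B : ℝ) ≤ p := by exact_mod_cast (le_max_left B 2).trans hpB
  have hp2 : (2 : ℝ) ≤ p := by exact_mod_cast (le_max_right B 2).trans hpB
  -- the witness window `(log p, 0)` (genuine: `0 < log p`) reaches `p`: `log p < 2 log p`
  have hlogp : 0 < Real.log p := Real.log_pos (by linarith)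
  obtain ⟨K, hK, v, hv⟩ := exists_dial_negative_gt (win := logWindow p hp.two_le) (logWindow p hp.two_le).ha
    (by rw [logWindow_a]; linarith) (zetaWeights_pos_of_prime hp)
  refine ⟨p, hp, K, hK, ?_, v, hv⟩
  -- membership: the dialled datum agrees with `ζ` on every window of `W` (locality)
  refine (hW zetaDatum _ fun win hwin => ?_).1 hζ
  show evenBlock zetaWeights win = evenBlock (dial p K zetaWeights) win
  rw [evenBlock_dial_of_not_mem ((hB win hwin).trans_le hpB')]

/-- **PROVED — THE LOCALITY BARRIER, set form (RH-free; witness named `≠ ζ`).** No criterion determined by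
finitely many windows contains `ζ`'s datum and misses the detectably negative part of the arithmetic dial space:
`S` contains a dial-space datum DIFFERENT FROM `ζ` that is detectably negative at a genuine window. [folklore] -/
theorem finitelyDetermined_meets_dialNegativesNe {S : Set Datum} (hS : FinitelyDetermined S)
    (hζ : zetaDatum ∈ S) : ∃ d ∈ dialSpace, d ≠ zetaDatum ∧ d ∈ S ∧ DetectablyNegative d := by
  obtain ⟨p, hp, K, hK, hmem, v, hv⟩ := exists_heavyDial_mem_negative hS hζ
  exact ⟨datumOf (dial p K zetaWeights), ⟨_, rfl⟩,
    datumOf_dial_ne hp.two_le hK.ne' (zetaWeights_pos_of_prime hp).ne', hmem, logWindow p hp.two_le, v, hv⟩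

/-- PROVED (v1 statement, kept verbatim — append-only; named-witness form `…Ne`). [folklore] -/
theorem finitelyDetermined_meets_dialNegatives {S : Set Datum} (hS : FinitelyDetermined S)
    (hζ : zetaDatum ∈ S) : ∃ d ∈ dialSpace, d ∈ S ∧ DetectablyNegative d :=
  let ⟨d, hd, _, h⟩ := finitelyDetermined_meets_dialNegativesNe hS hζ; ⟨d, hd, h⟩

/-- PROVED (corollary): no `τ_fin`-robust criterion (continuous functional of finitely many windows holding at `ζ`
with a margin) separates `ζ` from the dial-space negatives; the witness is a dial-space datum `≠ ζ`. [folklore] -/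
theorem finitelyRobustAt_meets_dialNegativesNe {S : Set Datum} (hS : FinitelyRobustAt S zetaDatum) :
    ∃ d ∈ dialSpace, d ≠ zetaDatum ∧ d ∈ S ∧ DetectablyNegative d := by
  obtain ⟨S', hS'S, hζ, hfd⟩ := hS.exists_finitelyDetermined
  obtain ⟨d, hdD, hne, hdS', hneg⟩ := finitelyDetermined_meets_dialNegativesNe hfd hζ
  exact ⟨d, hdD, hne, hS'S hdS', hneg⟩

/-- PROVED (v1 statement, kept verbatim — append-only; named-witness form `…Ne`). [folklore] -/
theorem finitelyRobustAt_meets_dialNegatives {S : Set Datum} (hS : FinitelyRobustAt S zetaDatum) :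
    ∃ d ∈ dialSpace, d ∈ S ∧ DetectablyNegative d :=
  let ⟨d, hd, _, h⟩ := finitelyRobustAt_meets_dialNegativesNe hS; ⟨d, hd, h⟩

/-- PROVED: hence no finitely determined criterion separates `ζ` from the negatives of any domain `D ⊇ dialSpace`. [folklore] -/
theorem not_separates_of_finitelyDetermined {S D : Set Datum} (hD : dialSpace ⊆ D) (hS : FinitelyDetermined S) :
    ¬ Separates S D zetaDatum := by
  rintro ⟨hζ, hneg⟩
  obtain ⟨d, hdD, hdS, hd⟩ := finitelyDetermined_meets_dialNegatives hS hζ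
  exact hneg d (hD hdD) hd hdS

/-! ## §6 The UNIFORM-MODULUS BARRIER (PROVED modulo accumulation) -/

/-- **PROVED**: if negatives of `D` accumulate at `d₀` uniformly, no `τ_unif`-robust criterion at `d₀` misses them. [folklore] -/
theorem not_uniformlyRobust_of_negativesAccumulate {S D : Set Datum} {d₀ : Datum}
    (hacc : NegativesAccumulate D d₀) (hS : UniformlyRobustAt S d₀) :
    ∃ d ∈ D, d ∈ S ∧ DetectablyNegative d := by
  obtain ⟨ε, hε, hS⟩ := hS
  obtain ⟨d, hdD, hneg, hclose⟩ := hacc ε hε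
  exact ⟨d, hdD, hS d hclose, hneg⟩

/-- **PROVED (named form, REFEREE r7 §1)**: if negatives of `D` OTHER THAN `d₀` accumulate at `d₀` uniformly, every
`τ_unif`-robust criterion at `d₀` contains a detectably negative member of `D` different from `d₀`. [folklore] -/
theorem not_uniformlyRobust_of_negativesAccumulateNe {S D : Set Datum} {d₀ : Datum}
    (hacc : NegativesAccumulateNe D d₀) (hS : UniformlyRobustAt S d₀) :
    ∃ d ∈ D, d ≠ d₀ ∧ d ∈ S ∧ DetectablyNegative d := by
  obtain ⟨ε, hε, hS⟩ := hS
  obtain ⟨d, hdD, hne, hneg, hclose⟩ := hacc ε hε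
  exact ⟨d, hdD, hne, hS d hclose, hneg⟩

/-- The SHIFT family `d − δ·1` (self-planted: lowers every Rayleigh quotient by exactly `δ |v|²`). [folklore] -/
def shift (δ : ℝ) (d : Datum) : Datum := fun win => d win - δ • (1 : Matrix (Fin (win.N + 1)) (Fin (win.N + 1)) ℝ)

/-- PROVED: the shift by `δ ≥ 0` is uniformly `δ`-close. [folklore] -/
theorem uniformlyClose_shift {δ : ℝ} (hδ : 0 ≤ δ) (d : Datum) : UniformlyClose δ d (shift δ d) := by
  intro win v
  have h : d win - shift δ d win = δ • (1 : Matrix (Fin (win.N + 1)) (Fin (win.N + 1)) ℝ) := by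
    simp [shift]
  rw [h, Matrix.smul_mulVec, Matrix.one_mulVec, dotProduct_smul, smul_eq_mul,
    abs_of_nonneg (mul_nonneg hδ (dotProduct_self_nonneg_real v))]

/-- PROVED: the Rayleigh quotient of the shift drops by `δ |v|²`. [folklore] -/
theorem rayleigh_shift (δ : ℝ) (d : Datum) (win : Window) (v : Fin (win.N + 1) → ℝ) :
    v ⬝ᵥ (shift δ d win *ᵥ v) = v ⬝ᵥ (d win *ᵥ v) - δ * (v ⬝ᵥ v) := by
  simp only [shift, Matrix.sub_mulVec, dotProduct_sub, Matrix.smul_mulVec, Matrix.one_mulVec,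
    dotProduct_smul, smul_eq_mul]

/-- **PROVED**: over the FULL operator domain, negatives accumulate uniformly at any datum whose Galerkin bottom
tends to zero (`GalerkinInfZero`, the TYPED upper-law input for `ζ`): NO criterion with an `a`-uniform modulus of
continuity (not even one reading `ε₁`) separates `ζ` from all negative operators (v1 statement; named form `…Ne`). [folklore] -/
theorem negativesAccumulate_univ_of_galerkinInfZero {d₀ : Datum} (h : GalerkinInfZero d₀) :
    NegativesAccumulate Set.univ d₀ := by
  intro ε hε
  obtain ⟨win, v, hv⟩ := h ε hε
  refine ⟨shift ε d₀, Set.mem_univ _, ⟨win, v, ?_⟩, uniformlyClose_shift hε.le d₀⟩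
  rw [rayleigh_shift]; linarith

/-- PROVED: a shift by `δ ≠ 0` CHANGES the datum (look at the `(0,0)` entry of the window `(1, 0)`). [folklore] -/
theorem shift_ne_self {δ : ℝ} (hδ : δ ≠ 0) (d : Datum) : shift δ d ≠ d := by
  intro h
  have h00 := congrArg (fun e : Datum => e ⟨1, 0, one_pos⟩ 0 0) h
  simp only [shift, Matrix.sub_apply, Matrix.smul_apply, Matrix.one_apply_eq, smul_eq_mul, mul_one] at h00
  exact hδ (by linarith)

/-- **PROVED (named form)**: over the FULL operator domain, negatives OTHER THAN `d₀` accumulate uniformly at any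
datum whose Galerkin bottom tends to zero (the shifts `d₀ − ε·1`, `ε > 0`, are never `d₀`). [folklore] -/
theorem negativesAccumulateNe_univ_of_galerkinInfZero {d₀ : Datum} (h : GalerkinInfZero d₀) :
    NegativesAccumulateNe Set.univ d₀ := by
  intro ε hε
  obtain ⟨win, v, hv⟩ := h ε hε
  refine ⟨shift ε d₀, Set.mem_univ _, shift_ne_self hε.ne' d₀, ⟨win, v, ?_⟩, uniformlyClose_shift hε.le d₀⟩
  rw [rayleigh_shift]; linarith

/-- **PROVED modulo PRIME-DIAL ACCUMULATION `NegativesAccumulate dialSpace zetaDatum`** (discharged in the barrier-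
prover's `PfPersistenceDialLemma.lean` modulo the TYPED `DialReady 2 β₀` = Galerkin upper law + pattern-form floor, DATA
R-PF3a / PF-N2, `…_of_dialReady'`): no `τ_unif`-robust criterion separates `ζ` from the dial-space negatives. [folklore] -/
theorem not_separates_of_uniformlyRobust (hacc : NegativesAccumulate dialSpace zetaDatum) {S D : Set Datum}
    (hD : dialSpace ⊆ D) (hS : UniformlyRobustAt S zetaDatum) : ¬ Separates S D zetaDatum := by
  rintro ⟨-, hneg⟩
  obtain ⟨d, hdD, hdS, hd⟩ := not_uniformlyRobust_of_negativesAccumulate hacc hS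
  exact hneg d (hD hdD) hd hdS

/-! ## §7 Where a surviving criterion must live (PROVED bookkeeping for the gap class) -/

/-- PROVED: the positive class is NOT finitely determined (it distinguishes data agreeing on any finite window set)
— bookkeeping showing `𝒫` itself lies outside the locality barrier's class, as it must. [folklore] -/
theorem positiveClass_not_finitelyDetermined : ¬ FinitelyDetermined positiveClass := by
  classical
  rintro ⟨W, hW⟩
  let B : ℝ := ((W.image fun win => ⌈win.a⌉₊).sup id : ℕ) + 1
  have hB : ∀ win ∈ W, win.a < B := by
    intro win hwin
    have h1 : win.a ≤ (⌈win.a⌉₊ : ℝ) := Nat.le_ceil _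
    have h2 : ⌈win.a⌉₊ ≤ (W.image fun win => ⌈win.a⌉₊).sup id :=
      Finset.le_sup (f := id) (Finset.mem_image_of_mem _ hwin)
    have h2' : (⌈win.a⌉₊ : ℝ) ≤ ((W.image fun win => ⌈win.a⌉₊).sup id : ℕ) := by exact_mod_cast h2
    have h3 : B = ((W.image fun win => ⌈win.a⌉₊).sup id : ℕ) + 1 := rfl
    linarith
  have hB0 : 0 < B := by show (0 : ℝ) < (_ : ℕ) + 1; positivity
  obtain ⟨win₀, hwin₀def⟩ : ∃ win₀ : Window, win₀ = ⟨B, 0, hB0⟩ := ⟨_, rfl⟩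
  have hwin₀ : win₀ ∉ W := fun h => by
    have := hB win₀ h
    rw [hwin₀def] at this
    exact lt_irrefl B this
  obtain ⟨d, hddef⟩ : ∃ d : Datum, d = fun win => if win = win₀ then -1 else 0 := ⟨_, rfl⟩
  have hagree : ∀ win ∈ W, (0 : Datum) win = d win := by
    intro win hwin
    have hne : win ≠ win₀ := fun h => hwin₀ (h ▸ hwin)
    simp [hddef, hne]
  have h0 : (0 : Datum) ∈ positiveClass := fun win v => by simp [Matrix.zero_mulVec]
  have hd : d ∈ positiveClass := (hW 0 d hagree).1 h0
  have h1 := hd win₀ (fun _ => 1)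
  have hdw : d win₀ = -1 := by simp [hddef]
  rw [hdw, Matrix.neg_mulVec, Matrix.one_mulVec, dotProduct_neg] at h1
  have h2 : (0 : ℝ) < (fun _ : Fin (win₀.N + 1) => (1 : ℝ)) ⬝ᵥ (fun _ => 1) := by
    simp [dotProduct]; positivity
  linarith

end Summit.RiemannHypothesis.RiemannHypothesis.Theorems.PfPersistence

end
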